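import Summits.ValiantsHypothesis.ValiantsHypothesis.Theorems.BarrierLeverChowHitsPartitionMinorsRMatchingDesign

/-!
# Route BarrierLever — item `ChowHitsPartitionMinorsR` (stmt-ValiantsHypothesis-21882):
# THEOREM A′ IS THE STARVED CASE OF THE MATCHING DESIGN, BY NAME: `IsStarvedPair u w → IsMDCertifiable u w`

Helper file (`--supports stmt-ValiantsHypothesis-21882`; cell valiant-natproofs, rung V4, 𝒟-side support item of route
BarrierLever; prover seat val-np-p5 gen 32; planner RULING R63(a) reading of record «THEOREM A′ is MD's proved starved case»,
RULING R69(c)). Definition-free. Closes NO item.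

The starved design of THEOREM A′ (`ChowStarvedDesign.det_starvedDesign_ne_zero`, p727261) — the `h` vertex forms
`1 + x_a + y_a` and, for each 3-column `j`, the form `1 + x_{α j} + x_{β j} + Σ_{c ∈ w j} y_c` — IS a matching design
(`ChowMD.mdForm`, p729761): re-match the defect row `{α j, β j}` to the column `w j`, weights `1`; defect rows that are not
matched pairs (there are none, but the proof does not need the count) get weights `0`, i.e. the trivial form `1`. Hence
`isMDCertifiable_of_isStarvedPair`, and the v4 hypothesis `¬ IsStarvedPair` of the registered nodes is implied by the NoMD
hypothesis `¬ IsMDCertifiable` (`not_isStarvedPair_of_not_isMDCertifiable`).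

WHAT THIS IS NOT: CONJECTURE MD is NOT proved (only its starved case); item 21882 is NOT proved; nothing on crux
stmt-ValiantsHypothesis-14610 or on `VP` versus `VNP`.
-/

set_option linter.dupNamespace false

open Finset MvPolynomial

noncomputable section

namespace Summit.ValiantsHypothesis.ValiantsHypothesis.Theorems.BarrierLever.ChowMD

open Summit.ValiantsHypothesis.ValiantsHypothesis.Theorems.BarrierLever.ChowStarvedDesign
  (IsStarvedPair desA desB det_starvedDesign_ne_zero)

variable {h r : ℕ}

section Starved

variable (w : Fin r → Finset (Fin h)) (O : Finset (Fin h)) (α β : {j : Fin r // (w j).card = 3} → Fin h)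
  (u : Fin r → Finset (Fin h)) (hw3 : ∀ k, (w k).card ≤ 3) (hucov : ∀ U : Finset (Fin h), U.card ≤ 2 → ∃ i, u i = U)
  (hw : Function.Injective w) (hu : Function.Injective u)
  (hne : ∀ j : {j : Fin r // (w j).card = 3}, ∀ k, w k ≠ {α j, β j})
  (hinjE : ∀ j j' : {j : Fin r // (w j).card = 3}, ({α j, β j} : Finset (Fin h)) = {α j', β j'} → j = j')
  (hα : ∀ j, α j ∈ O) (hβ : ∀ j, β j ∈ O) (hαβ : ∀ j, α j ≠ β j)
  (hK : ∀ j : {j : Fin r // (w j).card = 3}, ∀ c ∈ w j.1, c ∉ O)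
  (hsurj : ∀ a b : Fin h, a ≠ b → (∀ k, w k ≠ {a, b}) →
    ∃ j : {j : Fin r // (w j).card = 3}, ({α j, β j} : Finset (Fin h)) = {a, b})
  (hu2 : ∀ i, (u i).card ≤ 2) (hloww : ∀ j T, T ⊆ w j → ∃ k, w k = T)

/-- A defect row `i` is MATCHED when it is the pair `{α j, β j}` of some 3-column `j`. -/
def Matched (i : rowDefect u w) : Prop := ∃ j : {j : Fin r // (w j).card = 3}, u i.1 = {α j, β j}

/-- The re-matching of the starved design: a matched defect row goes to its 3-column, anything else stays put. -/
def starvedPhi (i : rowDefect u w) : Fin r := by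
  classical
  exact if hi : Matched w α β u i then (Classical.choose hi).1 else i.1

/-- The weights of the starved design: `1` on matched defect rows, `0` elsewhere. -/
def starvedWt (i : rowDefect u w) : ℂ := by
  classical
  exact if Matched w α β u i then 1 else 0

include hαβ hucov in
/-- The row index of the matched pair of a 3-column. -/
theorem exists_row_eq_pair (j : {j : Fin r // (w j).card = 3}) : ∃ i, u i = {α j, β j} :=
  hucov _ (by rw [Finset.card_pair (hαβ j)])

include hinjE in
/-- The 3-column of a matched defect row is unique. -/
theorem matched_unique {i : rowDefect u w} (hi : Matched w α β u i) (j : {j : Fin r // (w j).card = 3})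
    (hj : u i.1 = {α j, β j}) : Classical.choose hi = j :=
  hinjE _ _ ((Classical.choose_spec hi).symm.trans hj)

include hinjE in
/-- On a matched defect row the MD form is the pair form of THEOREM A′. -/
theorem mdForm_inr_matched (i : rowDefect u w) (j : {j : Fin r // (w j).card = 3}) (hj : u i.1 = {α j, β j}) :
    mdForm u w (starvedPhi w α β u) (starvedWt w α β u) (starvedWt w α β u) (Sum.inr i) =
      C 1 + ∑ a, C (desA w α β (Sum.inr j) a) * X (Fin.castAdd h a) + ∑ c, C (desB w (Sum.inr j) c) * X (Fin.natAdd h c) := by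
  classical
  have hi : Matched w α β u i := ⟨j, hj⟩
  have hch : Classical.choose hi = j := matched_unique w α β u hinjE hi j hj
  unfold mdForm
  congr 1
  · congr 1
    refine Finset.sum_congr rfl fun a _ => ?_
    simp only [mdA, starvedWt, if_pos hi, desA, hj, Finset.mem_insert, Finset.mem_singleton]
  · refine Finset.sum_congr rfl fun c _ => ?_
    simp only [mdB, starvedPhi, starvedWt, dif_pos hi, if_pos hi, hch, desB]

/-- On an unmatched defect row the MD form is the trivial form `1`. -/
theorem mdForm_inr_unmatched (i : rowDefect u w) (hi : ¬ Matched w α β u i) :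
    mdForm u w (starvedPhi w α β u) (starvedWt w α β u) (starvedWt w α β u) (Sum.inr i) = 1 := by
  classical
  unfold mdForm
  simp only [mdA, mdB, starvedWt, if_neg hi, ite_self, map_zero, zero_mul, Finset.sum_const_zero, add_zero, map_one]

/-- The vertex forms agree. -/
theorem mdForm_inl (a : Fin h) :
    mdForm u w (starvedPhi w α β u) (starvedWt w α β u) (starvedWt w α β u) (Sum.inl a) =
      C 1 + ∑ a', C (desA w α β (Sum.inl a) a') * X (Fin.castAdd h a') + ∑ c, C (desB w (Sum.inl a) c) * X (Fin.natAdd h c) := by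
  unfold mdForm
  simp only [mdA, mdB, desA, desB]

include hucov hu hne hinjE hαβ in
/-- **The MD product of the starved re-matching equals the starved design product of THEOREM A′.** -/
theorem prod_mdForm_starved :
    (∏ k, mdForm u w (starvedPhi w α β u) (starvedWt w α β u) (starvedWt w α β u) k) =
      ∏ k ∈ (Finset.univ : Finset (Fin h ⊕ {j : Fin r // (w j).card = 3})),
        ((C 1 + ∑ a, C (desA w α β k a) * X (Fin.castAdd h a) + ∑ c, C (desB w k c) * X (Fin.natAdd h c)) :
          MvPolynomial (Fin (h + h)) ℂ) := by
  classical
  rw [Fintype.prod_sum_type, Fintype.prod_sum_type]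
  have hinl : (∏ a : Fin h, mdForm u w (starvedPhi w α β u) (starvedWt w α β u) (starvedWt w α β u) (Sum.inl a)) =
      ∏ a : Fin h, ((C 1 + ∑ a', C (desA w α β (Sum.inl a) a') * X (Fin.castAdd h a') +
        ∑ c, C (desB w (Sum.inl a) c) * X (Fin.natAdd h c)) : MvPolynomial (Fin (h + h)) ℂ) :=
    Finset.prod_congr rfl fun a _ => mdForm_inl w α β u a
  rw [hinl]
  congr 1
  -- defect rows: matched ones carry the pair forms, unmatched ones the form `1`
  have hsplit : (∏ i : rowDefect u w, mdForm u w (starvedPhi w α β u) (starvedWt w α β u) (starvedWt w α β u) (Sum.inr i)) =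
      ∏ i : rowDefect u w, (if hi : Matched w α β u i then
        (C 1 + ∑ a, C (desA w α β (Sum.inr (Classical.choose hi)) a) * X (Fin.castAdd h a) +
          ∑ c, C (desB w (Sum.inr (Classical.choose hi)) c) * X (Fin.natAdd h c) : MvPolynomial (Fin (h + h)) ℂ)
        else 1) := by
    refine Finset.prod_congr rfl fun i _ => ?_
    by_cases hi : Matched w α β u i
    · rw [dif_pos hi]
      exact mdForm_inr_matched w α β u hinjE i _ (Classical.choose_spec hi)
    · rw [dif_neg hi]
      exact mdForm_inr_unmatched w α β u i hi
  rw [hsplit, Fintype.prod_dite, Fintype.prod_eq_one (fun _ : {i : rowDefect u w // ¬ Matched w α β u i} => (1 : MvPolynomial (Fin (h + h)) ℂ)) (fun _ => rfl), mul_one]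
  -- re-index the matched defect rows by the 3-columns
  let row : {j : Fin r // (w j).card = 3} → Fin r := fun j => Classical.choose (exists_row_eq_pair w α β u hucov hαβ j)
  have hrow : ∀ j, u (row j) = {α j, β j} := fun j => Classical.choose_spec (exists_row_eq_pair w α β u hucov hαβ j)
  have hdef : ∀ j, ∀ j', w j' ≠ u (row j) := fun j j' => by rw [hrow]; exact hne j j'
  let e : {j : Fin r // (w j).card = 3} → {i : rowDefect u w // Matched w α β u i} :=
    fun j => ⟨⟨row j, hdef j⟩, ⟨j, hrow j⟩⟩
  have he : Function.Bijective e := by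
    constructor
    · intro j j' hjj'
      have : row j = row j' := congrArg (fun x => x.1.1) hjj'
      exact hinjE _ _ (by rw [← hrow j, ← hrow j', this])
    · rintro ⟨⟨i, hi⟩, ⟨j, hj⟩⟩
      refine ⟨j, ?_⟩
      have : row j = i := hu ((hrow j).trans hj.symm)
      exact Subtype.ext (Subtype.ext this)
  rw [← (Equiv.ofBijective e he).prod_comp]
  refine Finset.prod_congr rfl fun j _ => ?_
  have hch : Classical.choose ((Equiv.ofBijective e he) j).2 = j :=
    matched_unique w α β u hinjE _ j (hrow j)
  simp only [hch]

include hw3 hucov hw hu hne hinjE hα hβ hαβ hK hsurj hu2 hloww in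
/-- **The starved re-matching certifies the pair** (THEOREM A′ transported). -/
theorem det_mdMatrix_starved_ne_zero :
    (mdMatrix u w (starvedPhi w α β u) (starvedWt w α β u) (starvedWt w α β u)).det ≠ 0 := by
  unfold mdMatrix
  rw [prod_mdForm_starved w α β u hucov hu hne hinjE hαβ]
  exact det_starvedDesign_ne_zero w O α β u hw3 hucov hw hu hne hinjE hα hβ hαβ hK hsurj hu2 hloww

end Starved

/-- **THEOREM A′ IS MD's STARVED CASE (R63(a), by name): every starved pair is MD-certifiable.** -/
theorem isMDCertifiable_of_isStarvedPair (u w : Fin r → Finset (Fin h)) (hS : IsStarvedPair u w) :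
    IsMDCertifiable u w := by
  obtain ⟨O, α, β, hw3, hucov, hw, hu, hne, hinjE, hα, hβ, hαβ, hK, hsurj, hu2, hloww⟩ := hS
  exact ⟨starvedPhi w α β u, starvedWt w α β u, starvedWt w α β u,
    det_mdMatrix_starved_ne_zero w O α β u hw3 hucov hw hu hne hinjE hα hβ hαβ hK hsurj hu2 hloww⟩

/-- Contrapositive, in the shape the registered nodes consume: not MD-certifiable ⇒ not starved. -/
theorem not_isStarvedPair_of_not_isMDCertifiable (u w : Fin r → Finset (Fin h)) (hN : ¬ IsMDCertifiable u w) :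
    ¬ IsStarvedPair u w :=
  fun hS => hN (isMDCertifiable_of_isStarvedPair u w hS)

/-- The MD budget of a starved pair: its row defect has at most `C(h,2)` rows (they are pairs inside the block, matched
injectively with 3-columns) — so `h + #rowDefect ≤ h + C(h,2) ≤ h·h`. Stated as the cardinality bound on matched rows:
the matched defect rows are in bijection with the 3-columns (`ChowStarvedDesign.card_threeCols_le_choose`). -/
theorem card_threeCols_le_of_isStarvedPair (u w : Fin r → Finset (Fin h)) (hS : IsStarvedPair u w) :
    Fintype.card {j : Fin r // (w j).card = 3} ≤ h.choose 2 := by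
  obtain ⟨O, α, β, -, -, -, -, -, hinjE, hα, hβ, hαβ, -, -, -, -⟩ := hS
  exact ChowStarvedDesign.card_threeCols_le_choose w O α β hinjE hα hβ hαβ

end Summit.ValiantsHypothesis.ValiantsHypothesis.Theorems.BarrierLever.ChowMD

end
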